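import Summits.RiemannHypothesis.RiemannHypothesis.Theorems.PfPersistenceM2UpperLeak
import HarnessLib

/-!
# M2 upper half (8/7 — addendum): the ENDPOINT FORM of the prolate leak (THEOREM E″ shape), `p = 3`

pub-rhpf cell (M2 seat, generation 3) — addendum to the 7-part M2 UPPER-HALF packet (`PfPersistenceM2UpperLawCount`,
`…ProlateWitness`, `…Mollified`, `…WindowSum`, `…LeakCriteria`, `…LeakAssembly`, `…UpperLeak`).  HONEST FRAMING:
long-odds MECHANISM SEARCH; no RH claims.  Everything in this file is PROVED (kernel-checked, RH-free) or an
explicitly named `@[conjecture] def … : Prop` taken as an argument; nothing here implies or assumes RH, and nothing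
bounds the Weil ground energy from below.

WHAT THIS ADDS.  The packet reduced the exponent-explicit upper Connes law to ONE typed prolate input
`ProlateLeakSup A p Λ` and proved `… → ConnesLawUpperWitnessWith (2p + 1 + δ)`; the connes-x13 bundle's THEOREM E′
gives `p = 9/2` on paper, which misses the M2 threshold `p < 3.9` (DATA).  The gen-3 seat DERIVED on paper (HOME/M2-ROUTE.md §9,
UNREFEREED; validated numerically, M2-DATA D10) a sharpening, THEOREM E″, whose SHAPE is: the leak is bounded by the
window-EDGE values of the two prolate functions — `ProlateLeakEndpoint C Λ` below — and those edge values are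
`O(N³ e^{−2πN})` by the classical prolate asymptotics (Fuchs 1964) — `ProlateEndpointData D Λ`.  PROVED here:
`ProlateLeakEndpoint C Λ₁ → ProlateEndpointData D Λ₂ → ProlateLeakSup (max C 1 · D) 3 (max Λ₁ Λ₂)`, hence
`… → ConnesLawUpperWitnessWith (7 + δ)` and `… → ConnesLawUpperWith (7 + δ)`: exponent `B_U = 7 + δ`, below the DATA
gap exponent `B_G ∈ [8.7, 9.3]`.  The two inputs are obligation nodes of OUR theory (E″ is unrefereed; Fuchs's
threshold is ineffective), not Literature facts.
-/

noncomputable section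

set_option linter.dupNamespace false  -- the mandated namespace repeats `RiemannHypothesis`

open Complex Filter Set Topology Metric MeasureTheory
open Literature.NumberTheory.LFunctions
open scoped ComplexConjugate Convolution

namespace Summit.RiemannHypothesis.RiemannHypothesis.Theorems.PfPersistenceM2Leak

/-! ### §N. The ENDPOINT FORM of the leak (THEOREM E″ shape) — the `p = 3` input split into STRUCTURE × DECAY

THEOREM E″ (HOME/M2-ROUTE.md §9; DERIVED on paper by the gen-3 M2 seat, UNREFEREED) bounds the in-window Riemann
sums of the Connes guess by its ENDPOINT DATA: `sup_{u<1/λ} |S_λ(u)| ≤ |h_λ(0)|/2 + (2 + o(1))·λ^{1/2}·(|a₄| ε₄ + |a₀| ε₀)`,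
`ε_k = λ^{1/2} |h_{k,λ}(λ)|` the window-edge value of the prolate function, `a₄ = κ₀`, `a₀ = −κ₀ρ`, `ρ = ∫h_{4,λ}/∫h_{0,λ}`.
With `λ = √N`, `λ^{1/2} ε_k = √N · |h_{k,λ}(√N)|`, this is `ProlateLeakEndpoint C Λ` below (the `κ₀` is absorbed in `C`;
E″ gives `C = κ₀ · 3` for `N ≥ 13`; its additive remainder `κ₀ λ^{1/2} (T₄ + |ρ| T₀)`, `T_k ≤ 3.6 e^{−1.10·2πN}` there, is below the
typed `+ e^{−2πN}` as soon as `|ρ| ≤ 2·10³ — any crude bound on `ρ = ∫h₄/∫h₀ → √3/2^{3/2}`, which `ProlateEndpointData` needs anyway).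
The classical prolate asymptotics (Fuchs 1964, §III: `ψ_k(1;c)² ≍ c^{k+3/2} e^{−2c}`, rigorous, ineffective threshold;
Slepian 1965) make the endpoint data `O(N³ e^{−2πN})`: `ProlateEndpointData D Λ`.  PROVED here: the two together
give `ProlateLeakSup (max C 1 · D) 3 (max Λ₁ Λ₂)`, hence (packet) `ConnesLawUpperWitnessWith (7 + δ)` — an exponent
BELOW the DATA gap exponent `B_G ∈ [8.7, 9.3]` of the M2 mechanism (M2-DATA D9).  Nothing here bounds `ε₁` from below. -/

section EndpointForm

/-- **HYPOTHESIS (E″-STRUCTURE), RH-free, prolate-only** (obligation node; DERIVED on paper as THEOREM E″ of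
HOME/M2-ROUTE.md §9 with `C = 3κ₀` for `Λ = 13`, UNREFEREED): for integer `N ≥ Λ` and `0 < u < 1/√N`,
`|𝓔(h_{√N})(u)| ≤ (|h_{√N}(0)|/2 + C √N (|h_{4,√N}(√N)| + |ρ| |h_{0,√N}(√N)|) + e^{−2πN}) · √u`
— the leak is controlled by the window-EDGE values of the two prolate functions (and is attained there: the
`m = 1` Poisson-dual sample as `u → (1/√N)⁻`). -/
@[conjecture] def ProlateLeakEndpoint (C Λ : ℝ) : Prop :=
  ∀ N : ℕ, Λ ≤ (N : ℝ) → ∀ f0 f4 : ℝ → ℝ,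
    IsProlateFunction (Real.sqrt N) 0 f0 → IsProlateFunction (Real.sqrt N) 4 f4 →
    ∀ u : ℝ, 0 < u → u < 1 / Real.sqrt N →
      |connesE (prolateGuessH (Real.sqrt N) f0 f4) u|
        ≤ (|prolateGuessH (Real.sqrt N) f0 f4 0| / 2
            + C * Real.sqrt N * (|f4 (Real.sqrt N)|
                + |(∫ y in (-Real.sqrt N)..Real.sqrt N, f4 y) / (∫ y in (-Real.sqrt N)..Real.sqrt N, f0 y)|
                    * |f0 (Real.sqrt N)|)
            + Real.exp (-(2 * Real.pi * N))) * Real.sqrt u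

/-- **HYPOTHESIS (ENDPOINT DECAY), RH-free, classical** (obligation node; on paper a THEOREM: Fuchs 1964
[J. Math. Anal. Appl. 9, §III + Lemma 1] gives `ψ_k(1;c)² = C_k c^{k+3/2} e^{−2c} (1 + o(1))`, so
`√N |h_{4,√N}(√N)| = N^{1/4} ψ₄(1; 2πN) ≍ N³ e^{−2πN}`, the `k = 0` term is `≍ N e^{−2πN}`, `|ρ| → √3/2^{3/2}`,
and `h_{√N}(0) = O(N^{−1/4} c^{9/2} e^{−4πN})` (bundle §3.2(iii)(a)); the threshold is ineffective in [Fuchs]):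
the endpoint data of the Connes guess is `≤ D N³ e^{−2πN}` for `N ≥ Λ`. -/
@[conjecture] def ProlateEndpointData (D Λ : ℝ) : Prop :=
  ∀ N : ℕ, Λ ≤ (N : ℝ) → ∀ f0 f4 : ℝ → ℝ,
    IsProlateFunction (Real.sqrt N) 0 f0 → IsProlateFunction (Real.sqrt N) 4 f4 →
      |prolateGuessH (Real.sqrt N) f0 f4 0| / 2
        + Real.sqrt N * (|f4 (Real.sqrt N)|
            + |(∫ y in (-Real.sqrt N)..Real.sqrt N, f4 y) / (∫ y in (-Real.sqrt N)..Real.sqrt N, f0 y)|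
                * |f0 (Real.sqrt N)|)
        + Real.exp (-(2 * Real.pi * N))
        ≤ D * (N : ℝ) ^ (3 : ℝ) * Real.exp (-(2 * Real.pi * N))

/-- **PROVED: STRUCTURE × DECAY ⇒ the `sup` leak with exponent `p = 3`.** -/
theorem prolateLeakSup_of_endpoint {C D Λ₁ Λ₂ : ℝ}
    (h1 : ProlateLeakEndpoint C Λ₁) (h2 : ProlateEndpointData D Λ₂) :
    ProlateLeakSup (max C 1 * D) 3 (max Λ₁ Λ₂) := by
  intro N hN f0 f4 h0 h4 u hu hul
  have hN1 : Λ₁ ≤ (N : ℝ) := (le_max_left _ _).trans hN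
  have hN2 : Λ₂ ≤ (N : ℝ) := (le_max_right _ _).trans hN
  have hE := h1 N hN1 f0 f4 h0 h4 u hu hul
  have hD := h2 N hN2 f0 f4 h0 h4
  -- abbreviations
  obtain ⟨P, hP⟩ : ∃ P : ℝ, P = |prolateGuessH (Real.sqrt N) f0 f4 0| / 2 := ⟨_, rfl⟩
  obtain ⟨Q, hQ⟩ : ∃ Q : ℝ, Q = Real.sqrt N * (|f4 (Real.sqrt N)|
      + |(∫ y in (-Real.sqrt N)..Real.sqrt N, f4 y) / (∫ y in (-Real.sqrt N)..Real.sqrt N, f0 y)|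
          * |f0 (Real.sqrt N)|) := ⟨_, rfl⟩
  obtain ⟨R, hR⟩ : ∃ R : ℝ, R = Real.exp (-(2 * Real.pi * N)) := ⟨_, rfl⟩
  obtain ⟨K, hK⟩ : ∃ K : ℝ, K = D * (N : ℝ) ^ (3 : ℝ) * Real.exp (-(2 * Real.pi * N)) := ⟨_, rfl⟩
  have hP0 : 0 ≤ P := by rw [hP]; positivity
  have hQ0 : 0 ≤ Q := by rw [hQ]; positivity
  have hR0 : 0 ≤ R := by rw [hR]; positivity
  have hE' : |connesE (prolateGuessH (Real.sqrt N) f0 f4) u| ≤ (P + C * Q + R) * Real.sqrt u := by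
    have : C * Real.sqrt N * (|f4 (Real.sqrt N)|
        + |(∫ y in (-Real.sqrt N)..Real.sqrt N, f4 y) / (∫ y in (-Real.sqrt N)..Real.sqrt N, f0 y)|
            * |f0 (Real.sqrt N)|) = C * Q := by rw [hQ]; ring
    rw [hP, hR, ← this]; exact hE
  have hD' : P + Q + R ≤ K := by rw [hP, hQ, hR, hK]; exact hD
  have hM1 : 1 ≤ max C 1 := le_max_right _ _
  have hMC : C ≤ max C 1 := le_max_left _ _
  have hM0 : 0 ≤ max C 1 := zero_le_one.trans hM1
  have hstep : P + C * Q + R ≤ max C 1 * (P + Q + R) := by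
    nlinarith [mul_le_mul_of_nonneg_right hMC hQ0, mul_le_mul_of_nonneg_right hM1 hP0,
      mul_le_mul_of_nonneg_right hM1 hR0]
  have hK0 : P + Q + R ≤ K := hD'
  calc |connesE (prolateGuessH (Real.sqrt N) f0 f4) u|
      ≤ (P + C * Q + R) * Real.sqrt u := hE'
    _ ≤ (max C 1 * K) * Real.sqrt u := by
        apply mul_le_mul_of_nonneg_right _ (Real.sqrt_nonneg u)
        exact hstep.trans (mul_le_mul_of_nonneg_left hK0 hM0)
    _ = max C 1 * D * (N : ℝ) ^ (3 : ℝ) * Real.exp (-(2 * Real.pi * N)) * Real.sqrt u := by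
        rw [hK]; ring

/-- **HEADLINE, endpoint form: the M2-passing exponent.**  E″-structure + endpoint decay + Slepian–Pollak
uniqueness + Fact 6.4 ⇒ normalised prolate-guess witnesses with `Re W ≤ C μ^{7+δ} e^{−4πμ}`
(`B_U = 7 + δ`, below the DATA gap exponent `B_G ≈ 8.8`).  No floor, no RH. -/
theorem connesLawUpperWitnessWith_seven_of_endpoint (hE : existsUnique_isProlateFunction)
    (hX : prolateGuess_tendsto_riemannXi) {C D Λ₁ Λ₂ : ℝ} (hD : 0 ≤ D)
    (h1 : ProlateLeakEndpoint C Λ₁) (h2 : ProlateEndpointData D Λ₂) {δ : ℝ} (hδ : 0 < δ) (hδ1 : δ ≤ 1) :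
    ConnesLawUpperWitnessWith (7 + δ) := by
  have h := connesLawUpperWitnessWith_of_prolateLeakSup hE hX (mul_nonneg (zero_le_one.trans (le_max_right C 1)) hD)
    (by norm_num : (0 : ℝ) ≤ 3) (prolateLeakSup_of_endpoint h1 h2) hδ hδ1
  rw [show (2 : ℝ) * 3 + 1 = 7 from by norm_num] at h
  exact h

/-- Energy form: `… → ConnesLawUpperWith (7 + δ) → ConnesLawUpper`. -/
theorem connesLawUpperWith_seven_of_endpoint (hE : existsUnique_isProlateFunction)
    (hX : prolateGuess_tendsto_riemannXi) {C D Λ₁ Λ₂ : ℝ} (hD : 0 ≤ D)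
    (h1 : ProlateLeakEndpoint C Λ₁) (h2 : ProlateEndpointData D Λ₂) {δ : ℝ} (hδ : 0 < δ) (hδ1 : δ ≤ 1) :
    ConnesLawUpperWith (7 + δ) := by
  have h := connesLawUpperWith_of_prolateLeakSup hE hX (mul_nonneg (zero_le_one.trans (le_max_right C 1)) hD)
    (by norm_num : (0 : ℝ) ≤ 3) (prolateLeakSup_of_endpoint h1 h2) hδ hδ1
  rw [show (2 : ℝ) * 3 + 1 = 7 from by norm_num] at h
  exact h

end EndpointForm

end Summit.RiemannHypothesis.RiemannHypothesis.Theorems.PfPersistenceM2Leak
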